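import Summits.HodgeConjecture.HodgeConjecture.Theorems.SoloInformedVerticalSupport
import Summits.HodgeConjecture.HodgeConjecture.Theorems.SoloInformedConiveauOneBirational
import Literature.AlgebraicGeometry.HodgeTheory.SaitoGrFDeRhamCurveNetHolds
import Literature.AlgebraicGeometry.HodgeTheory.LefschetzOneOneHolds
import Literature.AlgebraicGeometry.HodgeTheory.ComplexConjugationHolds
import Literature.AlgebraicGeometry.HodgeTheory.HodgeFiltrationModelsReductionProofs
import Literature.AlgebraicGeometry.Resolution.ProjectiveResolutionProofs
import Literature.AlgebraicTopology.SingularHomology.GysinMapSupportProofs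
import Literature.NumberTheory.Transcendental.DeRhamTheoremMultiplicative
import HarnessLib

/-!
# The Hodge conjecture is UNCONDITIONALLY equivalent to its coniveau-one, roof and vertical forms
(solo seat `solo-HodgeConjecture-informed`, fourth landing)

`Theorems/SoloInformedConiveauOne`, `…ConiveauOneBirational` and `…VerticalSupport` proved

* `HodgeConjecture ↔ C1` — every rational `(p,p)`-class with `2 ≤ p ≤ n/2` on a smooth projective
  `n`-fold dies on the complex points of the complement of some proper Zariski-closed subset
  (`supportedClasses X (2p) 1`, coniveau `≥ 1`);
* `HodgeConjecture ↔` every smooth projective `n`-fold has a birational ROOF to a model with `C1`;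
* `HodgeConjecture ↔` the VERTICAL-SUPPORT form (for every morphism `f : X ⟶ B` to a smooth
  projective `B` with `dim X < dim B + p`, every rational `(p,p)`-class dies off `f⁻¹T`, `T ⊊ B`
  closed);
* the Hodge conjecture in dimension `≤ 4` `↔ C1(4, 2)`,

each GRANTED the tree's named facts: Deligne's *Hodge III* Cor. 8.2.8, the semisimplicity lift of
Hodge classes along Gysin maps (Voisin 2025, Cor. 2.12), Gysin maps versus restriction to opens
(Fulton, *Young Tableaux* App. B), Hironaka's projective resolution, Lefschetz `(1,1)`, existence of
Hodge models (Serre GAGA + de Rham + Hodge decomposition), independence of the Hodge `(p,q)`-spaces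
of the model, and de Rham's theorem. Every one of these facts is by now a THEOREM of the tree:

| hypothesis of the session-1 theorems | discharged by |
|---|---|
| `Deligne1974_ker_restrictCompl_eq_iSup_range_complexGysin` | `Deligne1974_ker_restrictCompl_eq_iSup_range_complexGysin_holds` |
| `Voisin2025_hodgeClass_lift_complexGysin` | `Voisin2025_hodgeClass_lift_complexGysin_holds` |
| `gysinMap_restrictCompl_eq_zero ℂ` | `gysinMap_restrictCompl_eq_zero_of_field ℂ` |
| `Resolution.Hironaka1964_projective` | `Resolution.Hironaka1964_projective_holds` |
| `lefschetzOneOne_rational` | `lefschetzOneOne_rational_holds` |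
| `nonempty_hodgeModel n X` | `nonempty_hodgeModel_holds` |
| `hodgePQ_independent_of_hodgeModel` | `hodgePQ_independent_of_hodgeModel_holds` |
| `exists_deRhamIsoFamily 𝓘(ℝ, E)` | `Literature.NumberTheory.Transcendental.exists_deRhamIsoFamily_holds E` |

so the four equivalences hold with NO hypothesis at all. This file records them in that form
(primed names; the discharges are inlined, no auxiliary declaration is introduced). The content is unchanged; what changes is the status of the statements: they are
now kernel-checked reformulations of the summit `HodgeConjecture` itself, not of
"`HodgeConjecture` granted eight facts".

## Reading (solo PLAN `run/shared/lean/ideation/HodgeConjecture/solo-informed/PLAN.md`)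

`C1` isolates the one primitive a proof of the Hodge conjecture must perform, dimension by
dimension and only at or below the middle degree: make a rational `(p,p)`-class (`p ≥ 2`) vanish
on a non-empty Zariski open set — kill it at the generic point of `X`. By
`soloInformed_hodgeConjecture_iff_verticalSupport'` the open set may be sought VERTICALLY, as the
preimage of an open subset of the base of any fibration of fibre dimension `< p`; the companion
file `Theorems/SoloInformedCurveNet` specialises this to the net of curves every variety carries.

## References

* [DeligneHodgeIII1974] P. Deligne, Théorie de Hodge III, Publ. Math. IHÉS 44 (1974), Cor. 8.2.8.
* [Voisin2025] C. Voisin, Hodge and generalized Hodge conjectures, coniveau and algebraic cycles,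
  J. Open Math. Probl. 1 (2025), Cor. 2.12.
* [VoisinHodgeI2002] C. Voisin, Hodge Theory and Complex Algebraic Geometry I (2002), Thm. 11.30.
* [Kollar2007] J. Kollár, Lectures on Resolution of Singularities (2007), Thm. 3.27.
* [GrothendieckTopology1969] A. Grothendieck, Hodge's general conjecture is false for trivial
  reasons, Topology 8 (1969), pp. 300–301.
* [Deligne2000] P. Deligne, The Hodge conjecture, Clay Mathematics Institute (2000), §1.
-/

noncomputable section

open scoped Manifold
open CategoryTheory AlgebraicGeometry
open Literature.AlgebraicTopology.SingularHomology
open Literature.AlgebraicGeometry Literature.AlgebraicGeometry.HodgeTheory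
open Literature.NumberTheory.Transcendental (exists_deRhamIsoFamily exists_deRhamIsoFamily_holds)

namespace Summit.HodgeConjecture.HodgeConjecture.Theorems

/-! ### The four equivalences, unconditionally -/

/-- **`HodgeConjecture ↔ C1`, unconditionally.** The Hodge conjecture holds if and only if, for every
smooth projective complex `X` of dimension `n` and every `p` with `2 ≤ p` and `2p ≤ n`, every
rational class of Hodge type `(p,p)` in `H²ᵖ(X(ℂ); ℂ)` lies in `N¹ H²ᵖ(X(ℂ); ℂ) = supportedClasses X (2p) 1`,
i.e. vanishes on the complex points of the complement of some proper Zariski-closed subset of `X`.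
(`soloInformed_hodgeConjecture_iff_coniveauOne` fed with the eight discharged facts.)
[cite: GrothendieckTopology1969, pp. 300–301] [cite: DeligneHodgeIII1974, Cor. 8.2.8]
[cite: Voisin2025, Cor. 2.12] [cite: Deligne2000, §1] -/
theorem soloInformed_hodgeConjecture_iff_coniveauOne' :
    _root_.HodgeConjecture ↔
      ∀ ⦃n : ℕ⦄ ⦃X : Motives.SchemeOver ℂ⦄, Motives.IsSmoothProjective n X →
        ∀ (p : ℕ) (c : complexBetti X (2 * p)), 2 ≤ p → 2 * p ≤ n → IsRationalClass c →
          IsOfHodgeType n X (2 * p) p p c → c ∈ supportedClasses X (2 * p) 1 :=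
  soloInformed_hodgeConjecture_iff_coniveauOne
    Deligne1974_ker_restrictCompl_eq_iSup_range_complexGysin_holds
    Voisin2025_hodgeClass_lift_complexGysin_holds (gysinMap_restrictCompl_eq_zero_of_field ℂ)
    Resolution.Hironaka1964_projective_holds lefschetzOneOne_rational_holds
    (fun _ _ ↦ nonempty_hodgeModel_holds)

/-- **The first open case, unconditionally**: the Hodge conjecture (cycle part) for all smooth
projective complex varieties of dimension `≤ 4` is equivalent to `C1(4, 2)` — every rational
`(2,2)`-class on every smooth projective fourfold vanishes on the complex points of the complement of
some proper Zariski-closed subset. [cite: GrothendieckTopology1969, pp. 300–301]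
[cite: DeligneHodgeIII1974, Cor. 8.2.8] [cite: Voisin2025, Cor. 2.12] -/
theorem soloInformed_hodgeClasses_algebraic_dim_le_four_iff_coniveauOne_two_two' :
    (∀ ⦃n : ℕ⦄ ⦃X : Motives.SchemeOver ℂ⦄, n ≤ 4 → Motives.IsSmoothProjective n X →
        ∀ (p : ℕ) (c : complexBetti X (2 * p)), IsRationalClass c →
          IsOfHodgeType n X (2 * p) p p c → c ∈ algebraicClasses X p) ↔
      ∀ ⦃X : Motives.SchemeOver ℂ⦄, Motives.IsSmoothProjective 4 X →
        ∀ c : complexBetti X (2 * 2), IsRationalClass c → IsOfHodgeType 4 X (2 * 2) 2 2 c →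
          c ∈ supportedClasses X (2 * 2) 1 :=
  soloInformed_hodgeClasses_algebraic_dim_le_four_iff_coniveauOne_two_two
    Deligne1974_ker_restrictCompl_eq_iSup_range_complexGysin_holds
    Voisin2025_hodgeClass_lift_complexGysin_holds (gysinMap_restrictCompl_eq_zero_of_field ℂ)
    Resolution.Hironaka1964_projective_holds lefschetzOneOne_rational_holds

/-- **`HodgeConjecture ↔` the roof form, unconditionally**: the Hodge conjecture holds iff every
smooth projective complex `n`-fold `M` admits a roof `M ⟵ Z ⟶ M₀` of birational morphisms of
smooth projective `n`-folds whose right foot `M₀` satisfies `C1(n, p)` for all `2 ≤ p ≤ n/2`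
(`C1` is a birational invariant: `soloInformed_coniveauOne_iff_of_isBirational`).
[cite: Fulton1998, Lemma 19.1.2] [cite: GrothendieckTopology1969, pp. 300–301] -/
theorem soloInformed_hodgeConjecture_iff_coniveauOne_roof' :
    _root_.HodgeConjecture ↔
      ∀ ⦃n : ℕ⦄ ⦃M : Motives.SchemeOver ℂ⦄, Motives.IsSmoothProjective n M →
        ∃ (Z M₀ : Motives.SchemeOver ℂ) (b : Z ⟶ M) (b₀ : Z ⟶ M₀),
          Motives.IsSmoothProjective n Z ∧ Motives.IsSmoothProjective n M₀ ∧
          Resolution.IsBirational b.left ∧ Resolution.IsBirational b₀.left ∧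
          ∀ (p : ℕ) (c : complexBetti M₀ (2 * p)), 2 ≤ p → 2 * p ≤ n → IsRationalClass c →
            IsOfHodgeType n M₀ (2 * p) p p c → c ∈ supportedClasses M₀ (2 * p) 1 :=
  soloInformed_hodgeConjecture_iff_coniveauOne_roof
    Deligne1974_ker_restrictCompl_eq_iSup_range_complexGysin_holds
    Voisin2025_hodgeClass_lift_complexGysin_holds (gysinMap_restrictCompl_eq_zero_of_field ℂ)
    Resolution.Hironaka1964_projective_holds lefschetzOneOne_rational_holds
    (fun _ _ ↦ nonempty_hodgeModel_holds) hodgePQ_independent_of_hodgeModel_holds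
    (fun E _ _ _ ↦ exists_deRhamIsoFamily_holds E)

/-- **`HodgeConjecture ↔` the vertical-support form, unconditionally**: the Hodge conjecture holds
iff for every smooth projective `X` of dimension `n`, every rational `(p,p)`-class `c` with
`2 ≤ p ≤ n/2`, every smooth projective `B` of dimension `m` and every morphism `f : X ⟶ B` over `ℂ`
with `n < m + p`, the class `c` vanishes on the complex points of `X ∖ f⁻¹T` for some proper
Zariski-closed `T ⊊ B`. [cite: Hartshorne1977, II Ex. 3.22] [cite: GrothendieckTopology1969, §1] -/
theorem soloInformed_hodgeConjecture_iff_verticalSupport' :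
    _root_.HodgeConjecture ↔
      ∀ ⦃n : ℕ⦄ ⦃X : Motives.SchemeOver ℂ⦄, Motives.IsSmoothProjective n X →
        ∀ (p : ℕ) (c : complexBetti X (2 * p)), 2 ≤ p → 2 * p ≤ n → IsRationalClass c →
          IsOfHodgeType n X (2 * p) p p c →
          ∀ ⦃m : ℕ⦄ ⦃B : Motives.SchemeOver ℂ⦄, Motives.IsSmoothProjective m B →
            ∀ f : X ⟶ B, n < m + p →
              ∃ T : Set B.left, IsClosed T ∧ T ≠ Set.univ ∧
                complexBetti.restrictCompl X (f.left.base ⁻¹' T) (2 * p) c = 0 :=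
  soloInformed_hodgeConjecture_iff_verticalSupport
    Deligne1974_ker_restrictCompl_eq_iSup_range_complexGysin_holds
    Voisin2025_hodgeClass_lift_complexGysin_holds (gysinMap_restrictCompl_eq_zero_of_field ℂ)
    Resolution.Hironaka1964_projective_holds lefschetzOneOne_rational_holds
    (fun _ _ ↦ nonempty_hodgeModel_holds)

end Summit.HodgeConjecture.HodgeConjecture.Theorems

end
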